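import Summits.ValiantsHypothesis.ValiantsHypothesis.Theses.UnpaddedGIT
import Literature.Computability.AlgebraicComplexity.EquivariantDC

/-!
# Birth skeleton — piece `SliceTorusSymmetrizationQP` (child-to-be of `UnpaddedGIT.InvariantSeparationQP`,
strategist split v2, planner-cstrat-stmt-ValiantsHypothesis-5758-r1-0, 2026-08-17)

Border torus-symmetrization on the `ℂ[S_n]`-slice = DE-BORDERING on the slice (border pencil size
`qp` ⇒ exact pencil size `qp₁`, for permutation-supported forms) + EXACT-TO-EQUIVARIANT
SYMMETRIZATION on the slice (an exact pencil coefficient representation of a permutation-supported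
form of size `qp₁` yields a limit of torus-equivariant = `ℤ^{2n}`-graded representations of size
`qp'`). Sorries only in the two `stub_*`; `SliceTorusSymmetrizationQP_of` is a real proof (pure
logic, thresholds `max`).
-/

set_option linter.dupNamespace false

namespace Summit.ValiantsHypothesis.ValiantsHypothesis.Cruxes.InvariantSeparationQP.Split

open Literature.Computability.AlgebraicComplexity

/-- The piece, verbatim (it becomes `Theses.UnpaddedGIT.SliceTorusSymmetrizationQP` on `--split`). -/
def SliceTorusSymmetrizationQP : Prop :=
  ∀ c : ℕ, ∃ c' n₀ : ℕ, ∀ n ≥ n₀, ∀ m : ℕ, m ≤ 2 ^ ((Nat.log 2 n + c) ^ c) → ∀ f : MvPolynomial (Fin n × Fin n) ℂ, (∀ s ∈ f.support, ∃ ρ : Equiv.Perm (Fin n), s = ∑ i, Finsupp.single (ρ i, i) 1) → Literature.Computability.AlgebraicComplexity.coeffVec f ∈ Literature.Computability.AlgebraicComplexity.zariskiClosure (Literature.Computability.AlgebraicComplexity.coeffVec '' {g : MvPolynomial (Fin n × Fin n) ℂ | ∃ A : Matrix (Fin m) (Fin m) (MvPolynomial (Fin n × Fin n) ℂ), (∀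 i j, (A i j).totalDegree ≤ 1) ∧ MvPolynomial.homogeneousComponent n A.det = g}) → ∃ m' : ℕ, m' ≤ 2 ^ ((Nat.log 2 n + c') ^ c') ∧ Literature.Computability.AlgebraicComplexity.coeffVec f ∈ Literature.Computability.AlgebraicComplexity.zariskiClosure (Literature.Computability.AlgebraicComplexity.coeffVec '' {g : MvPolynomial (Fin n × Fin n) ℂ | Literature.Computability.AlgebraicComplexity.HasEquivariantDetRepr (Subgroup.closure {γ : Matrix.GeneralLinearGroup (Fin n × Fin n) ℂ | ∃ d e : Fin n → ℂ, (γ : Matrix (Fin n × Fin n) (Fin n × Fin n) ℂ) = Matrix.diagonal (fun p => d p.1 * e p.2)}) g m'})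

/-- The slice predicate: `f` is permutation-supported. -/
def IsSliceForm {n : ℕ} (f : MvPolynomial (Fin n × Fin n) ℂ) : Prop :=
  ∀ s ∈ f.support, ∃ ρ : Equiv.Perm (Fin n), s = ∑ i, Finsupp.single (ρ i, i) 1

/-- The pencil-coefficient family `D_m(n)`, literal. -/
def pencilSet (n m : ℕ) : Set (MvPolynomial (Fin n × Fin n) ℂ) :=
  {g | ∃ A : Matrix (Fin m) (Fin m) (MvPolynomial (Fin n × Fin n) ℂ),
    (∀ i j, (A i j).totalDegree ≤ 1) ∧ MvPolynomial.homogeneousComponent n A.det = g}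

/-- The torus-equivariant family of size `m`. -/
def torusSet (n m : ℕ) : Set (MvPolynomial (Fin n × Fin n) ℂ) :=
  {g | HasEquivariantDetRepr (Subgroup.closure {γ : Matrix.GeneralLinearGroup (Fin n × Fin n) ℂ |
    ∃ d e : Fin n → ℂ, (γ : Matrix (Fin n × Fin n) (Fin n × Fin n) ℂ) =
      Matrix.diagonal (fun p => d p.1 * e p.2)}) g m}

/-- **stub_sliceDeborder** — de-bordering on the slice with quasi-polynomial loss: a
permutation-supported form in the Zariski closure of `coeffVec '' D_m(n)`, `m ≤ qp_c(n)`, lies in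
`D_{m₁}(n)` itself for some `m₁ ≤ qp_{c₁}(n)`, uniformly. Why plausibly true: the slice is a
torus weight space, so a border witness can be torus-normalised (Hilbert–Mumford / Borel fixed
point on the closed graph) and graded limits of pencils of size `m` are pencils of size
`poly(m, n)` (interpolation over the grading); the general de-bordering question (Mulmuley's
`VP ≠ \overline{VP}`?) is not needed, only its slice. Size: L–XL. -/
theorem stub_sliceDeborder :
    ∀ c : ℕ, ∃ c₁ n₀ : ℕ, ∀ n ≥ n₀, ∀ m : ℕ, m ≤ 2 ^ ((Nat.log 2 n + c) ^ c) →
      ∀ f : MvPolynomial (Fin n × Fin n) ℂ, IsSliceForm f →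
        coeffVec f ∈ zariskiClosure (coeffVec '' pencilSet n m) →
        ∃ m₁ : ℕ, m₁ ≤ 2 ^ ((Nat.log 2 n + c₁) ^ c₁) ∧ f ∈ pencilSet n m₁ := by
  sorry

/-- **stub_sliceSymmetrizeExact** — exact-to-equivariant symmetrization on the slice (the torus
form of Landsberg–Ressayre's Question 2.2, for every permutation-supported form, with border
conclusion): an exact pencil-coefficient representation of size `m₁ ≤ qp_{c₁}(n)` of a slice form
`f` yields membership of `f` in the closure of the torus-equivariant family of size `qp'(n)`.
Why plausibly true: the torus acts on the variety of size-`m₁` pencils representing `f` modulo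
gauge; a torus-fixed point of a suitable compactification (Borel) is a GRADED pencil, and the model
is not generically weak (det, cyclic-shift sums, Kasteleyn/bounded-treewidth permanents are graded
of polynomial size). HARDEST stub. Size: XL / open. -/
theorem stub_sliceSymmetrizeExact :
    ∀ c₁ : ℕ, ∃ c' n₀ : ℕ, ∀ n ≥ n₀, ∀ m₁ : ℕ, m₁ ≤ 2 ^ ((Nat.log 2 n + c₁) ^ c₁) →
      ∀ f : MvPolynomial (Fin n × Fin n) ℂ, IsSliceForm f → f ∈ pencilSet n m₁ →
        ∃ m' : ℕ, m' ≤ 2 ^ ((Nat.log 2 n + c') ^ c') ∧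
          coeffVec f ∈ zariskiClosure (coeffVec '' torusSet n m') := by
  sorry

/-- **Composition (real proof, pure logic).** -/
theorem SliceTorusSymmetrizationQP_of
    (hD : ∀ c : ℕ, ∃ c₁ n₀ : ℕ, ∀ n ≥ n₀, ∀ m : ℕ, m ≤ 2 ^ ((Nat.log 2 n + c) ^ c) →
      ∀ f : MvPolynomial (Fin n × Fin n) ℂ, IsSliceForm f →
        coeffVec f ∈ zariskiClosure (coeffVec '' pencilSet n m) →
        ∃ m₁ : ℕ, m₁ ≤ 2 ^ ((Nat.log 2 n + c₁) ^ c₁) ∧ f ∈ pencilSet n m₁)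
    (hS : ∀ c₁ : ℕ, ∃ c' n₀ : ℕ, ∀ n ≥ n₀, ∀ m₁ : ℕ, m₁ ≤ 2 ^ ((Nat.log 2 n + c₁) ^ c₁) →
      ∀ f : MvPolynomial (Fin n × Fin n) ℂ, IsSliceForm f → f ∈ pencilSet n m₁ →
        ∃ m' : ℕ, m' ≤ 2 ^ ((Nat.log 2 n + c') ^ c') ∧
          coeffVec f ∈ zariskiClosure (coeffVec '' torusSet n m')) :
    SliceTorusSymmetrizationQP := by
  intro c
  obtain ⟨c₁, n₁, h₁⟩ := hD c
  obtain ⟨c', n₂, h₂⟩ := hS c₁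
  refine ⟨c', max n₁ n₂, fun n hn m hm f hf hmem => ?_⟩
  obtain ⟨m₁, hm₁, hf₁⟩ := h₁ n (le_of_max_le_left hn) m hm f hf hmem
  exact h₂ n (le_of_max_le_right hn) m₁ hm₁ f hf hf₁

end Summit.ValiantsHypothesis.ValiantsHypothesis.Cruxes.InvariantSeparationQP.Split
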